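import Summits.Parity.GeneralizedHardyLittlewood.Theorems.Dhl42BridgeH2
import Summits.Parity.GeneralizedHardyLittlewood.Theorems.Dhl42StaircaseInstance

/-!
# DHL[42,2] certificate — hypothesis (H2) of Proposition 4.4 at the §7 instance

§5 of the package file: the normalised logarithm `nlog x d = (2/(θ log x)) log d`, `deltag`, the
(H2) range exponents `rangeExp` with eq. (4.4) `rangeExp_eq`, the identification of `gradeData42`
with `(Lg, cg, ig)`, and Lemma 4.5 applied to `omega_admissible`: pieces of the sieve weights at
corners of `(OmegaF^{+ϱ}, OmegaG^{+ϱ})` produce `i_g`-tuply `x^{δ_g}`-densely divisible moduli in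
the ranges of (H2).

Origin: `Dhl42/BridgeH2.lean` of the DHL[42,2] certificate package (pub-dhl42 bundle, archive blob
`18cce9e3`; sha256[:16] of the file `d683540e473e658e`; paper snapshot = `paper/main.tex` v1), lines
:314–:439; statements and proofs unchanged except: namespace `TpY4Dhl42` →
`Summit.Parity.GeneralizedHardyLittlewood.Theorems.Dhl42`, the package's `simplexSet n B` replaced
by the tree's definitionally equal `Literature.NumberTheory.Sieve.scaledSimplex n B` (also inside
declaration names), docstrings added where missing, `#print axioms` lines dropped. Package-internal
references in the verbatim docstrings (`Dhl42/….lean`, `Assumed.…`, `row 9…`, `gen n`,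
`inputs/COMPARE.md`) refer to that package (paper Appendix B).

Declarations (13): `nlog`, `deltag`, `rangeExp`, `theta_pos`, `rangeExp_eq`, `cg_eq`,
`gradeData42_c`, `gradeData42_L`, `gradeData42_i'`, `deltag_nonneg`, `instance_translation`,
`hypothesisH2_of_admissible`, `hypothesisH2_of_admissible'`.
-/

open Finset
open Literature.NumberTheory.Sieve (DenselyDivisible)

namespace Summit.Parity.GeneralizedHardyLittlewood.Theorems.Dhl42

/-! ### §5. The Section-7 instance: hypothesis (H2) of Proposition 4.4 for pieces at corners of
`(Ω^{+ϱ}, Ω'^{+ϱ})`, `Ω = OmegaF`, `Ω' = OmegaG` -/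

noncomputable section

/-- The normalised logarithm of the proof of Lemma 4.5: `λ log d` with `λ = 2/(θ log x)`, so that
`t = λ log d ⟺ d = x^{θt/2}` (`§4.1`: "`log_x d_j ≈ (θ/2) t_j`"). -/
def nlog (x : ℝ) (d : ℕ) : ℝ := 2 / (theta * Real.log x) * Real.log d

/-- `δ_g` for the three grades of Section 7. -/
def deltag : Fin 3 → ℝ := ![delta1, delta2, delta3]

/-- The exponents of the ranges in hypothesis (H2) of Proposition 4.4 at the instance:
`q > x^{1/2 − ε₁'}` (`ε₁' = ε₁θ/2`) for `g = 1`, `q > x^{1/2 + 2ϖ_{g−1}}` for `g = 2, 3`. -/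
def rangeExp : Fin 3 → ℝ := ![1 / 2 - eps1 * theta / 2, 1 / 2 + 2 * varpi1, 1 / 2 + 2 * varpi2]

/-- `0 < θ` (`θ = 1/2 + 2ϖ₃`). -/
theorem theta_pos : 0 < theta := by unfold theta varpi3; norm_num

/-- Eq. (4.4) `eq:qLg` at the instance: the (H2) thresholds are `x^{(θ/2) L_g}`. -/
theorem rangeExp_eq (g : Fin 3) : rangeExp g = theta / 2 * Lg g := by
  have hθ : theta ≠ 0 := theta_pos.ne'
  fin_cases g
  · simp [rangeExp, Lg, lvl]; field_simp
  · simp [rangeExp, Lg]; field_simp; ring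
  · simp [rangeExp, Lg]; field_simp; ring

/-- `c_g = 2δ_g/θ` for the three grades of Section 7.1 (eq. (6)), with `δ_g = deltag g`. -/
theorem cg_eq (g : Fin 3) : cg g = 2 * deltag g / theta := by
  fin_cases g <;> simp [cg, deltag]

/-- The `c`-component of the §7.1 grade data is `cg` (definitional). -/
theorem gradeData42_c (g : Fin 3) : gradeData42.c g = cg g := rfl
/-- The `L`-component of the §7.1 grade data is `Lg` (definitional). -/
theorem gradeData42_L (g : Fin 3) : gradeData42.L g = Lg g := rfl
/-- The multiplicity component of the §7.1 grade data is `ig` (definitional). -/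
theorem gradeData42_i' (g : Fin 3) : gradeData42.i g = ig g := rfl

/-- `δ_g ≥ 0` for the three grades of Section 7.1. -/
theorem deltag_nonneg (g : Fin 3) : 0 ≤ deltag g := by
  fin_cases g <;> simp [deltag, delta1, delta2, delta3]

/-- The "`x` large" side conditions and the range condition of (H2), translated into the
hypotheses of `denselyDivisible_of_admissible` for `λ = 2/(θ log x)`, `y = x^{δ_g}`. -/
theorem instance_translation {x : ℝ} (hx : 1 < x) (g : Fin 3) :
    0 < 2 / (theta * Real.log x) ∧ 1 ≤ x ^ deltag g ∧
    gradeData42.c g = 2 / (theta * Real.log x) * Real.log (x ^ deltag g) ∧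
    (∀ {W : ℕ}, W ≠ 0 → (W : ℝ) ≤ x ^ (theta * rho0 / 4) →
      2 / (theta * Real.log x) * Real.log W ≤ rho0 / 2) ∧
    (∀ {p : ℕ}, 0 < p → (p : ℝ) ≤ x ^ deltag g →
      2 / (theta * Real.log x) * Real.log p ≤ gradeData42.c g) ∧
    (∀ {q : ℕ}, x ^ rangeExp g < (q : ℝ) → gradeData42.L g < 2 / (theta * Real.log x) * Real.log q) := by
  have hθ := theta_pos
  have hx0 : 0 < x := by linarith
  have hL : 0 < Real.log x := Real.log_pos hx
  have hθL : 0 < theta * Real.log x := mul_pos hθ hL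
  have hlam : 0 < 2 / (theta * Real.log x) := div_pos two_pos hθL
  have hc : gradeData42.c g = 2 / (theta * Real.log x) * Real.log (x ^ deltag g) := by
    rw [gradeData42_c, cg_eq, Real.log_rpow hx0]
    field_simp
  refine ⟨hlam, Real.one_le_rpow hx.le (deltag_nonneg g), hc, ?_, ?_, ?_⟩
  · intro W hW0 hWle
    have hW1 : (0 : ℝ) < W := by exact_mod_cast Nat.pos_of_ne_zero hW0
    have h1 : Real.log W ≤ theta * rho0 / 4 * Real.log x := by
      rw [← Real.log_rpow hx0]
      exact Real.log_le_log hW1 hWle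
    calc 2 / (theta * Real.log x) * Real.log W
        ≤ 2 / (theta * Real.log x) * (theta * rho0 / 4 * Real.log x) :=
          mul_le_mul_of_nonneg_left h1 hlam.le
      _ = rho0 / 2 := by field_simp; ring
  · intro p hp0 hple
    have hp0' : (0 : ℝ) < p := by exact_mod_cast hp0
    rw [hc]
    exact mul_le_mul_of_nonneg_left (Real.log_le_log hp0' hple) hlam.le
  · intro q hq
    have hxq : 0 < x ^ rangeExp g := Real.rpow_pos_of_pos hx0 _
    have hq0 : (0 : ℝ) < q := lt_trans hxq hq
    have h1 : rangeExp g * Real.log x < Real.log q := by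
      rw [← Real.log_rpow hx0]
      exact Real.log_lt_log hxq hq
    rw [rangeExp_eq] at h1
    rw [gradeData42_L]
    calc Lg g = 2 / (theta * Real.log x) * (theta / 2 * Lg g * Real.log x) := by
          field_simp
      _ < 2 / (theta * Real.log x) * Real.log q := mul_lt_mul_of_pos_left h1 hlam

/-- **Hypothesis (H2) of Proposition 4.4 at the Section-7 instance, from the admissibility of
`(Ω, Ω') = (OmegaF, OmegaG)` (Proposition 5.3, `omega_admissible`) via Lemma 4.5** — part (i):
pieces `f_j` (`j ≠ m`) at a corner `a ∈ Ω^{+ϱ}` and `g_j` at a corner `a' ∈ Ω'^{+ϱ}`, `0 ≤ ϱ ≤ ϱ₀/2`.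
For `x > 1`, divisors `d_j` (`j ≠ m`), `d'_j` of a squarefree `q = W r` with `λ log d_j ∈ [a_j, a_j + ϱ]`,
`λ log d'_j ∈ [a'_j, a'_j + ϱ]` (`λ = 2/(θ log x)`), `r ∣ ∏_{j≠m} d_j ∏_j d'_j`, and `W ≤ x^{θϱ₀/4}`
(i.e. `λ log W ≤ ϱ₀/2`; in the paper `log_x W = o(1)`): for each grade `g`, if every prime of `W` is
`≤ x^{δ_g}` (in the paper `p ≤ w` and `λ log w < c_g`) and `q > x^{rangeExp g}` (`= x^{1/2−ε₁'}`,
`x^{1/2+2ϖ₁}`, `x^{1/2+2ϖ₂}`), then `q` is `i_g`-tuply `x^{δ_g}`-densely divisible. -/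
theorem hypothesisH2_of_admissible {x : ℝ} (hx : 1 < x) {ϱ : ℝ} (hϱ : 0 ≤ ϱ) (hϱ2 : 2 * ϱ ≤ rho0)
    (m : Fin 42) {a : Fin 42 → ℝ} {a' : Fin 41 → ℝ}
    (ha : a ∈ thicken OmegaF ϱ) (ha' : a' ∈ thicken OmegaG ϱ) {d : Fin 42 → ℕ} {d' : Fin 41 → ℕ}
    (hd : ∀ j, j ≠ m → a j ≤ nlog x (d j) ∧ nlog x (d j) ≤ a j + ϱ)
    (hd' : ∀ j, a' j ≤ nlog x (d' j) ∧ nlog x (d' j) ≤ a' j + ϱ)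
    {q W r : ℕ} (hq : Squarefree q) (hqWr : q = W * r)
    (hr : r ∣ (∏ j ∈ univ.erase m, d j) * ∏ j, d' j)
    (hdq : ∀ j, j ≠ m → d j ∣ q) (hd'q : ∀ j, d' j ∣ q)
    (hWx : (W : ℝ) ≤ x ^ (theta * rho0 / 4)) (g : Fin 3)
    (hWp : ∀ p ∈ W.primeFactors, (p : ℝ) ≤ x ^ deltag g) (hqx : x ^ rangeExp g < (q : ℝ)) :
    DenselyDivisible (x ^ deltag g) (ig g) q := by
  obtain ⟨hlam, hy, hc, hWm, hWc, hqL⟩ := instance_translation hx g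
  have hW0 : W ≠ 0 := left_ne_zero_of_mul (hqWr ▸ Squarefree.ne_zero hq)
  rw [← gradeData42_i']
  exact denselyDivisible_of_admissible gradeData42 omega_admissible hϱ hϱ2 m ha ha' hlam hy g hc
    hd hd' hq hqWr hr hdq hd'q (fun p hp => hWc (Nat.pos_of_mem_primeFactors hp) (hWp p hp))
    (hWm hW0 hWx) (hqL hqx)

/-- **Hypothesis (H2) at the instance, part (ii)** (both families at corners `a', a'' ∈ Ω'^{+ϱ}`;
the second assertion of Lemma 4.5). -/
theorem hypothesisH2_of_admissible' {x : ℝ} (hx : 1 < x) {ϱ : ℝ} (hϱ : 0 ≤ ϱ) (hϱ2 : 2 * ϱ ≤ rho0)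
    {a' a'' : Fin 41 → ℝ} (ha' : a' ∈ thicken OmegaG ϱ) (ha'' : a'' ∈ thicken OmegaG ϱ)
    {d' d'' : Fin 41 → ℕ}
    (hd' : ∀ j, a' j ≤ nlog x (d' j) ∧ nlog x (d' j) ≤ a' j + ϱ)
    (hd'' : ∀ j, a'' j ≤ nlog x (d'' j) ∧ nlog x (d'' j) ≤ a'' j + ϱ)
    {q W r : ℕ} (hq : Squarefree q) (hqWr : q = W * r)
    (hr : r ∣ (∏ j, d' j) * ∏ j, d'' j) (hd'q : ∀ j, d' j ∣ q) (hd''q : ∀ j, d'' j ∣ q)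
    (hWx : (W : ℝ) ≤ x ^ (theta * rho0 / 4)) (g : Fin 3)
    (hWp : ∀ p ∈ W.primeFactors, (p : ℝ) ≤ x ^ deltag g) (hqx : x ^ rangeExp g < (q : ℝ)) :
    DenselyDivisible (x ^ deltag g) (ig g) q := by
  obtain ⟨hlam, hy, hc, hWm, hWc, hqL⟩ := instance_translation hx g
  have hW0 : W ≠ 0 := left_ne_zero_of_mul (hqWr ▸ Squarefree.ne_zero hq)
  rw [← gradeData42_i']
  exact denselyDivisible_of_admissible' gradeData42 omega_admissible hϱ hϱ2 ha' ha'' hlam hy g hc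
    hd' hd'' hq hqWr hr hd'q hd''q (fun p hp => hWc (Nat.pos_of_mem_primeFactors hp) (hWp p hp))
    (hWm hW0 hWx) (hqL hqx)

end

end Summit.Parity.GeneralizedHardyLittlewood.Theorems.Dhl42
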